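import Literature.NumberTheory.ComplexMultiplication.CMTypeRankSharedCharacter
import Literature.AlgebraicGeometry.Pohlmann1968.NondegenerateCMAlgebraTypes
import HarnessLib

/-!
# Two CM fields SHARING an imaginary quadratic subfield: the family of their CM types is DEGENERATE as soon as both
# signature defects on the shared field are non-zero (e.g. both relative degrees odd) — the Weil-type obstruction

Number-field form of `NumberTheory/ComplexMultiplication/CMTypeRankSharedCharacter` (abstract: two slots carrying
weights that transform under the SAME character of `G` and pair non-trivially with their types have
`dim U(Σ) < Σ_i dim U(Φ_i)`, so `Σ` is degenerate and no partial conjugation exists).  Setting: CM fields `K_i`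
(`i ∈ I`), an imaginary quadratic field `k` (`[k : ℚ] = 2`, totally complex) with a fixed complex embedding `ι₀`, and two
slots `i₀ ≠ i₁` with ring embeddings `j₀ : k → K_{i₀}`, `j₁ : k → K_{i₁}`.  The weight of an embedding `φ : K_i → ℂ` is its
SIGN on `k`: `+1` if `φ ∘ j_i = ι₀`, `−1` if `φ ∘ j_i = ῑ₀`; under `g ∈ Aut(ℂ)` both signs transform by the same factor
`χ(g) = ±1` (whether `g` fixes `ι₀(k)` or conjugates it: `ksign_smul`).  The pairing of the sign with the type
`Φ_i` is `2 (n⁺_i − n⁻_i)`, twice the SIGNATURE DEFECT of `Φ_i` on `k` (`n^±_i` = number of `φ ∈ Φ_i` with `φ|_k = ι₀`,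
resp. `ῑ₀`; `pairing_ksign_eq`).  Hence:

* **`cmFamilyRank_add_card_lt_of_shared_quadratic`** — if both signature defects are non-zero then
  `cmFamilyRank Φ + |I| < Σ_i cmTypeRank Φ_i + 1`: `rank Hg(∏_i A_{Φ_i}) < Σ_i rank Hg(A_{Φ_i})`, whatever the other slots;
* **`not_isNondegenerateFamily_of_shared_quadratic`** — the family is DEGENERATE (`¬ IsNondegenerateFamily Φ`), even
  if every `Φ_i` is nondegenerate: by Hazama–Murty (`Pohlmann1968.exists_exceptional_prod_of_not_isNondegenerateFamily`,
  for separating families) some `∏ A_i^{k_i}` carries an exceptional Hodge class — the Weil classes of `k`;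
* **`not_isNondegenerateFamily_of_shared_quadratic_of_odd`** — the defects are automatically non-zero when
  `[K_{i₀} : ℚ]/2` and `[K_{i₁} : ℚ]/2` are ODD (odd relative degree over `k`), e.g. two cyclic sextic CM fields through the
  same imaginary quadratic field (`ℚ(ζ_7)` and `ℚ(√−7)·ℚ(ζ_9)⁺`), or `k` itself (`E_k`) and any `K ⊇ k` with `[K : k]` odd;
* **`not_forall_exists_partialConj_of_shared_quadratic`** — in this situation no system of partial conjugations exists:
  the exact complement, for fields through a common imaginary quadratic field, of the criterion of
  `PartialConjugationOfRealIntersection` (`L_{i₀} ∩ L_{i₁} ⊇ ι₀(k)` is not totally real).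

Everything is proved; no definition, no named fact, no `sorry`.

## References

* [Gordon1999HodgeAVSurvey] B. B. Gordon, *A survey of the Hodge conjecture for abelian varieties*, §3 Theorem (Imai,
  Murty) and proof; 7.5–7.7 (Murty: `rank Hg < rdim` iff exceptional classes on some power).
* [Deligne1982HodgeCycles] P. Deligne, *Hodge cycles on abelian varieties*, LNM 900 (1982), I Ex. 3.7 and §4 (Weil classes
  for an imaginary quadratic field acting with signature defect).
-/

set_option autoImplicit false

noncomputable section

open scoped BigOperators
open NumberField NumberField.ComplexEmbedding Module

namespace Literature.NumberTheory.ComplexMultiplication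

open Literature.AlgebraicGeometry.Motives (CMType)
open Literature.AlgebraicGeometry.Pohlmann1968

/-! ### The two embeddings of an imaginary quadratic field and the action of `Aut(ℂ)` on them -/

section Quadratic

variable {k : Type} [Field k] [NumberField k] [IsTotallyComplex k]

omit [NumberField k] in
/-- No embedding of a totally complex field is real: `ῑ ≠ ι`. [folklore] -/
private theorem conjugate_ne_self_of_isTotallyComplex (ι : k →+* ℂ) : conjugate ι ≠ ι := fun h =>
  IsTotallyComplex.complexEmbedding_not_isReal ι (ComplexEmbedding.isReal_iff.2 h)

/-- An imaginary quadratic field has exactly the two complex embeddings `ι₀`, `ῑ₀`. [folklore] -/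
private theorem embedding_eq_or_eq_conjugate (hk : finrank ℚ k = 2) (ι₀ t : k →+* ℂ) : t = ι₀ ∨ t = conjugate ι₀ := by
  classical
  by_contra h
  push Not at h
  have hle : ({ι₀, conjugate ι₀, t} : Finset (k →+* ℂ)).card ≤ 2 := by
    rw [← hk, ← Embeddings.card k ℂ]
    exact Finset.card_le_univ _
  have h3 : ({ι₀, conjugate ι₀, t} : Finset (k →+* ℂ)).card = 3 := by
    rw [Finset.card_insert_of_notMem, Finset.card_pair fun h' => h.2 h'.symm]
    simp only [Finset.mem_insert, Finset.mem_singleton, not_or]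
    exact ⟨(conjugate_ne_self_of_isTotallyComplex ι₀).symm, fun h' => h.1 h'.symm⟩
  omega

/-- `g ∈ Aut(ℂ)` swaps or fixes the pair `{ι₀, ῑ₀}`: `g • ῑ₀ = ι₀ ↔ g • ι₀ ≠ ι₀`. [folklore] -/
private theorem smul_conjugate_eq_iff (hk : finrank ℚ k = 2) (ι₀ : k →+* ℂ) (g : ℂ ≃+* ℂ) :
    g • conjugate ι₀ = ι₀ ↔ g • ι₀ ≠ ι₀ := by
  have hinj : g • conjugate ι₀ ≠ g • ι₀ := fun h =>
    conjugate_ne_self_of_isTotallyComplex ι₀ ((smul_left_cancel_iff g).1 h)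
  constructor
  · intro h1 h2
    exact hinj (h1.trans h2.symm)
  · intro h2
    rcases embedding_eq_or_eq_conjugate hk ι₀ (g • conjugate ι₀) with h' | h'
    · exact h'
    · rcases embedding_eq_or_eq_conjugate hk ι₀ (g • ι₀) with h | h
      · exact absurd h h2
      · exact absurd (h'.trans h.symm) hinj

end Quadratic

/-! ### The sign of an embedding on a shared imaginary quadratic field -/

section Sign

variable {k : Type} [Field k] [NumberField k] [IsTotallyComplex k] {K : Type} [Field K] [NumberField K]

omit [NumberField K] in
open scoped Classical in
/-- **The `k`-sign transforms under the character of `Aut(ℂ)` on `Hom(k, ℂ)`**: writing `f(φ) = ±1` according as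
`φ ∘ j = ι₀` or `ῑ₀` and `χ(g) = ±1` according as `g ∘ ι₀ = ι₀` or `ῑ₀`, one has `f(g ∘ φ) = χ(g) f(φ)`.
[cite: Gordon1999HodgeAVSurvey, §3 Theorem (proof)] -/
theorem ksign_smul (hk : finrank ℚ k = 2) (ι₀ : k →+* ℂ) (j : k →+* K) (g : ℂ ≃+* ℂ) (φ : K →+* ℂ) :
    (if (g • φ).comp j = ι₀ then (1 : ℚ) else -1) =
      (if g • ι₀ = ι₀ then (1 : ℚ) else -1) * (if φ.comp j = ι₀ then (1 : ℚ) else -1) := by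
  have hcomp : (g • φ).comp j = g • (φ.comp j) := rfl
  rw [hcomp]
  rcases embedding_eq_or_eq_conjugate hk ι₀ (φ.comp j) with h | h
  · rw [h, if_pos rfl, mul_one]
  · rw [h, if_neg (conjugate_ne_self_of_isTotallyComplex ι₀)]
    by_cases hg : g • ι₀ = ι₀
    · have hne : ¬ g • conjugate ι₀ = ι₀ := fun h' => ((smul_conjugate_eq_iff hk ι₀ g).1 h') hg
      rw [if_pos hg, if_neg hne]
      norm_num
    · rw [if_neg hg, if_pos ((smul_conjugate_eq_iff hk ι₀ g).2 hg)]
      norm_num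

omit [NumberField K] in
open scoped Classical in
/-- The `k`-sign is odd under complex conjugation of the embedding: `f(φ̄) = −f(φ)`. [folklore] -/
private theorem ksign_conjugate (hk : finrank ℚ k = 2) (ι₀ : k →+* ℂ) (j : k →+* K) (φ : K →+* ℂ) :
    (if (conjugate φ).comp j = ι₀ then (1 : ℚ) else -1) = -(if φ.comp j = ι₀ then (1 : ℚ) else -1) := by
  have hcomp : (conjugate φ).comp j = conjugate (φ.comp j) := rfl
  rw [hcomp]
  rcases embedding_eq_or_eq_conjugate hk ι₀ (φ.comp j) with h | h
  · rw [h, if_neg (conjugate_ne_self_of_isTotallyComplex ι₀), if_pos rfl]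
  · rw [h, ComplexEmbedding.involutive_conjugate k ι₀, if_pos rfl, if_neg (conjugate_ne_self_of_isTotallyComplex ι₀)]
    norm_num

omit [NumberField K] in
/-- `u_1(Φ)(φ) = ±1` according as `φ ∈ Φ` or not. [folklore] -/
private theorem antiVec_one_eq_ite (Φ : Set (K →+* ℂ)) (φ : K →+* ℂ) [Decidable (φ ∈ Φ)] :
    antiVec Φ (1 : ℂ ≃+* ℂ) φ = if φ ∈ Φ then (1 : ℚ) else -1 := by
  by_cases h : φ ∈ Φ
  · rw [if_pos h, antiVec, translateInd_of_mem (by rwa [one_smul])]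
    norm_num
  · rw [if_neg h, antiVec, translateInd_of_not_mem (by rwa [one_smul])]
    norm_num

open scoped Classical in
/-- **The pairing of the `k`-sign with a CM type is twice the sum of the signs over the type**:
`Σ_φ f(φ) u_1(Φ)(φ) = 2 Σ_{φ ∈ Φ} f(φ)` (`f` and `u_1(Φ)` are both odd under `φ ↦ φ̄`, which exchanges `Φ` and its
complement). [cite: Deligne1982HodgeCycles, §4] -/
theorem pairing_ksign_eq (hk : finrank ℚ k = 2) (ι₀ : k →+* ℂ) (j : k →+* K) (Φ : CMType K) :
    ∑ φ : K →+* ℂ, (if φ.comp j = ι₀ then (1 : ℚ) else -1) * antiVec Φ.1 (1 : ℂ ≃+* ℂ) φ =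
      2 * ∑ φ ∈ Finset.univ.filter (fun φ : K →+* ℂ => φ ∈ Φ.1), (if φ.comp j = ι₀ then (1 : ℚ) else -1) := by
  set f : (K →+* ℂ) → ℚ := fun φ => if φ.comp j = ι₀ then (1 : ℚ) else -1 with hfdef
  have hsplit : ∑ φ : K →+* ℂ, f φ * antiVec Φ.1 (1 : ℂ ≃+* ℂ) φ =
      (∑ φ ∈ Finset.univ.filter (fun φ : K →+* ℂ => φ ∈ Φ.1), f φ) -
        ∑ φ ∈ Finset.univ.filter (fun φ : K →+* ℂ => φ ∉ Φ.1), f φ := by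
    have h1 : ∀ φ : K →+* ℂ, f φ * antiVec Φ.1 (1 : ℂ ≃+* ℂ) φ = if φ ∈ Φ.1 then f φ else -f φ := fun φ => by
      rw [antiVec_one_eq_ite]
      split_ifs <;> ring
    rw [Finset.sum_congr rfl fun φ _ => h1 φ, Finset.sum_ite, Finset.sum_neg_distrib, sub_eq_add_neg]
  -- the complement is the conjugate image of `Φ`, on which `f` changes sign
  have hcompl : ∑ φ ∈ Finset.univ.filter (fun φ : K →+* ℂ => φ ∉ Φ.1), f φ =
      -∑ φ ∈ Finset.univ.filter (fun φ : K →+* ℂ => φ ∈ Φ.1), f φ := by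
    rw [← Finset.sum_neg_distrib]
    refine Finset.sum_nbij' (fun φ => conjugate φ) (fun φ => conjugate φ) ?_ ?_ ?_ ?_ ?_
    · intro φ hφ
      simp only [Finset.mem_filter, Finset.mem_univ, true_and] at hφ ⊢
      by_contra h'
      exact hφ ((Φ.2 φ).2 h')
    · intro φ hφ
      simp only [Finset.mem_filter, Finset.mem_univ, true_and] at hφ ⊢
      exact (Φ.2 φ).1 hφ
    · intro φ _
      exact ComplexEmbedding.involutive_conjugate K φ
    · intro φ _
      exact ComplexEmbedding.involutive_conjugate K φ
    · intro φ _
      change f φ = -f (conjugate φ)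
      rw [hfdef]
      simp only
      rw [ksign_conjugate hk ι₀ j φ, neg_neg]
  rw [hsplit, hcompl]
  ring

omit [NumberField k] [IsTotallyComplex k] in
open scoped Classical in
/-- **… and that sum is the signature defect `n⁺ − n⁻`** (`n⁺ = #{φ ∈ Φ | φ ∘ j = ι₀}`, `n⁻ = #{φ ∈ Φ | φ ∘ j = ῑ₀}`).
[cite: Deligne1982HodgeCycles, §4] -/
theorem sum_ksign_eq_card_sub_card (ι₀ : k →+* ℂ) (j : k →+* K) (Φ : CMType K) :
    ∑ φ ∈ Finset.univ.filter (fun φ : K →+* ℂ => φ ∈ Φ.1), (if φ.comp j = ι₀ then (1 : ℚ) else -1) =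
      ((Finset.univ.filter fun φ : K →+* ℂ => φ ∈ Φ.1 ∧ φ.comp j = ι₀).card : ℚ) -
        ((Finset.univ.filter fun φ : K →+* ℂ => φ ∈ Φ.1 ∧ ¬ φ.comp j = ι₀).card : ℚ) := by
  rw [Finset.sum_ite, Finset.sum_const, Finset.sum_const, Finset.filter_filter, Finset.filter_filter, nsmul_eq_mul,
    nsmul_eq_mul, mul_one, mul_neg, mul_one, sub_eq_add_neg]

omit [NumberField k] [IsTotallyComplex k] in
open scoped Classical in
/-- **Odd relative degree forces a non-zero signature defect**: if `|Φ| = [K : ℚ]/2` is odd then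
`Σ_{φ ∈ Φ} f(φ) ≠ 0` (a sum of an odd number of `±1`'s). [cite: Deligne1982HodgeCycles, §4] -/
theorem sum_ksign_ne_zero_of_odd (ι₀ : k →+* ℂ) (j : k →+* K) (Φ : CMType K)
    (hodd : Odd (Finset.univ.filter (fun φ : K →+* ℂ => φ ∈ Φ.1)).card) :
    ∑ φ ∈ Finset.univ.filter (fun φ : K →+* ℂ => φ ∈ Φ.1), (if φ.comp j = ι₀ then (1 : ℚ) else -1) ≠ 0 := by
  rw [sum_ksign_eq_card_sub_card]
  have hsum := Finset.card_filter_add_card_filter_not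
    (s := Finset.univ.filter (fun φ : K →+* ℂ => φ ∈ Φ.1)) (fun φ : K →+* ℂ => φ.comp j = ι₀)
  rw [Finset.filter_filter, Finset.filter_filter] at hsum
  intro h
  rw [sub_eq_zero, Nat.cast_inj] at h
  rw [h, ← two_mul] at hsum
  exact (Nat.not_even_iff_odd.2 hodd) ⟨_, hsum.symm.trans (two_mul _)⟩

/-- `|Φ| = [K : ℚ]/2`: a CM type consists of `n` of the `2n` embeddings, one from each pair `{φ, φ̄}` (`φ ↦ φ̄` is a
bijection `Φ → Φᶜ`; "`{φ₁, …, φₙ, φ₁ρ, …, φₙρ}` is exactly the set of all embeddings"). [cite: Shimura1998, §18.1] -/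
theorem two_mul_card_filter_mem_cmType (Φ : CMType K) [DecidablePred (· ∈ Φ.1)] :
    2 * (Finset.univ.filter (fun φ : K →+* ℂ => φ ∈ Φ.1)).card = finrank ℚ K := by
  have hc : (Finset.univ.filter (fun φ : K →+* ℂ => φ ∉ Φ.1)).card =
      (Finset.univ.filter (fun φ : K →+* ℂ => φ ∈ Φ.1)).card := by
    refine Finset.card_nbij' (fun φ => conjugate φ) (fun φ => conjugate φ) ?_ ?_ ?_ ?_
    · intro φ hφ
      simp only [Finset.mem_coe, Finset.mem_filter, Finset.mem_univ, true_and] at hφ ⊢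
      by_contra h'
      exact hφ ((Φ.2 φ).2 h')
    · intro φ hφ
      simp only [Finset.mem_coe, Finset.mem_filter, Finset.mem_univ, true_and] at hφ ⊢
      exact (Φ.2 φ).1 hφ
    · intro φ _
      exact ComplexEmbedding.involutive_conjugate K φ
    · intro φ _
      exact ComplexEmbedding.involutive_conjugate K φ
  have hsum := Finset.card_filter_add_card_filter_not (s := (Finset.univ : Finset (K →+* ℂ)))
    (fun φ : K →+* ℂ => φ ∈ Φ.1)
  rw [hc, Finset.card_univ, Embeddings.card] at hsum
  omega

end Sign

/-! ### Degeneracy of families through a shared imaginary quadratic field -/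

section Family

variable {I : Type} {K : I → Type} [∀ i, Field (K i)] [∀ i, NumberField (K i)] [∀ i, IsCMField (K i)] [Fintype I]
  [Nonempty I]
variable {k : Type} [Field k] [NumberField k] [IsTotallyComplex k]

open scoped Classical in
/-- **Shared imaginary quadratic field, non-zero signature defects ⟹ the rank is not additive**:
`cmFamilyRank Φ + |I| < Σ_i cmTypeRank Φ_i + 1`, i.e. `rank Hg(∏_i A_{Φ_i}) < Σ_i rank Hg(A_{Φ_i})`.
[cite: Gordon1999HodgeAVSurvey, §3 Theorem (proof) and 7.5] -/
theorem cmFamilyRank_add_card_lt_of_shared_quadratic (hk : finrank ℚ k = 2) (ι₀ : k →+* ℂ) {i₀ i₁ : I}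
    (h01 : i₀ ≠ i₁) (j₀ : k →+* K i₀) (j₁ : k →+* K i₁) (Φ : ∀ i, CMType (K i))
    (hd₀ : ∑ φ ∈ Finset.univ.filter (fun φ : K i₀ →+* ℂ => φ ∈ (Φ i₀).1),
      (if φ.comp j₀ = ι₀ then (1 : ℚ) else -1) ≠ 0)
    (hd₁ : ∑ φ ∈ Finset.univ.filter (fun φ : K i₁ →+* ℂ => φ ∈ (Φ i₁).1),
      (if φ.comp j₁ = ι₀ then (1 : ℚ) else -1) ≠ 0) :
    CMAlgebra.cmFamilyRank Φ + Fintype.card I < (∑ i, cmTypeRank (Φ i)) + 1 := by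
  have hc₀ : ∑ φ : K i₀ →+* ℂ, (if φ.comp j₀ = ι₀ then (1 : ℚ) else -1) * antiVec (Φ i₀).1 (1 : ℂ ≃+* ℂ) φ ≠ 0 := by
    rw [pairing_ksign_eq hk ι₀ j₀ (Φ i₀)]
    exact mul_ne_zero two_ne_zero hd₀
  have hc₁ : ∑ φ : K i₁ →+* ℂ, (if φ.comp j₁ = ι₀ then (1 : ℚ) else -1) * antiVec (Φ i₁).1 (1 : ℂ ≃+* ℂ) φ ≠ 0 := by
    rw [pairing_ksign_eq hk ι₀ j₁ (Φ i₁)]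
    exact mul_ne_zero two_ne_zero hd₁
  exact typeRank_sigmaType_add_card_lt_of_shared (G := ℂ ≃+* ℂ) (Φ := fun i => (Φ i).1)
    (fun i => isCMTypeWith_conj (Φ i)) h01 (fun g => if g • ι₀ = ι₀ then (1 : ℚ) else -1)
    (fun φ => if φ.comp j₀ = ι₀ then (1 : ℚ) else -1) (fun φ => if φ.comp j₁ = ι₀ then (1 : ℚ) else -1)
    (fun g φ => ksign_smul hk ι₀ j₀ g φ) (fun g φ => ksign_smul hk ι₀ j₁ g φ) hc₀ hc₁

open scoped Classical in
/-- **Shared imaginary quadratic field, non-zero signature defects ⟹ the family is DEGENERATE**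
(`¬ IsNondegenerateFamily Φ`), whatever the other slots and even if every `Φ_i` is nondegenerate — on abelian
varieties: some `∏_i A_i^{k_i}` carries an exceptional Hodge class (the Weil classes of `k`).
[cite: Gordon1999HodgeAVSurvey, 7.5–7.7] [cite: Deligne1982HodgeCycles, §4] -/
theorem not_isNondegenerateFamily_of_shared_quadratic (hk : finrank ℚ k = 2) (ι₀ : k →+* ℂ) {i₀ i₁ : I}
    (h01 : i₀ ≠ i₁) (j₀ : k →+* K i₀) (j₁ : k →+* K i₁) (Φ : ∀ i, CMType (K i))
    (hd₀ : ∑ φ ∈ Finset.univ.filter (fun φ : K i₀ →+* ℂ => φ ∈ (Φ i₀).1),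
      (if φ.comp j₀ = ι₀ then (1 : ℚ) else -1) ≠ 0)
    (hd₁ : ∑ φ ∈ Finset.univ.filter (fun φ : K i₁ →+* ℂ => φ ∈ (Φ i₁).1),
      (if φ.comp j₁ = ι₀ then (1 : ℚ) else -1) ≠ 0) :
    ¬ CMAlgebra.IsNondegenerateFamily Φ := by
  intro hnd
  rw [CMAlgebra.isNondegenerateFamily_iff] at hnd
  have hlt := cmFamilyRank_add_card_lt_of_shared_quadratic hk ι₀ h01 j₀ j₁ Φ hd₀ hd₁
  have hle : ∀ i, cmTypeRank (Φ i) ≤ finrank ℚ (K i) / 2 + 1 := fun i => cmTypeRank_le (Φ i)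
  have hsum : ∑ i, cmTypeRank (Φ i) ≤ ∑ i, (finrank ℚ (K i) / 2 + 1) := Finset.sum_le_sum fun i _ => hle i
  rw [Finset.sum_add_distrib, Finset.sum_const, Finset.card_univ, smul_eq_mul, mul_one] at hsum
  -- `Σ_i [K_i:ℚ]/2 = (Σ_i [K_i:ℚ]) / 2` (all degrees are even)
  have hev : ∀ i ∈ (Finset.univ : Finset I), 2 ∣ finrank ℚ (K i) := fun i _ =>
    ⟨(Finset.univ.filter (fun φ : K i →+* ℂ => φ ∈ (Φ i).1)).card, (two_mul_card_filter_mem_cmType (Φ i)).symm⟩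
  have hdiv : (∑ i, finrank ℚ (K i)) / 2 = ∑ i, finrank ℚ (K i) / 2 := by
    rw [Nat.div_eq_iff_eq_mul_left two_pos (Finset.dvd_sum hev), Finset.sum_mul]
    exact Finset.sum_congr rfl fun i hi => (Nat.div_mul_cancel (hev i hi)).symm
  rw [hdiv] at hnd
  omega

open scoped Classical in
/-- **Odd relative degrees**: if `[K_{i₀} : ℚ]/2` and `[K_{i₁} : ℚ]/2` are odd (equivalently `[K_{i_k} : k]` is odd),
every family of CM types of CM fields `K_{i₀} ⊇ k ⊆ K_{i₁}` is degenerate — e.g. two cyclic sextic CM fields through the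
same imaginary quadratic field, for ALL types, although every primitive sextic type is nondegenerate (Ribet).
[cite: Gordon1999HodgeAVSurvey, 7.5–7.7] [cite: Deligne1982HodgeCycles, §4] -/
theorem not_isNondegenerateFamily_of_shared_quadratic_of_odd (hk : finrank ℚ k = 2) (ι₀ : k →+* ℂ) {i₀ i₁ : I}
    (h01 : i₀ ≠ i₁) (j₀ : k →+* K i₀) (j₁ : k →+* K i₁) (h₀ : Odd (finrank ℚ (K i₀) / 2))
    (h₁ : Odd (finrank ℚ (K i₁) / 2)) (Φ : ∀ i, CMType (K i)) : ¬ CMAlgebra.IsNondegenerateFamily Φ := by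
  refine not_isNondegenerateFamily_of_shared_quadratic hk ι₀ h01 j₀ j₁ Φ
    (sum_ksign_ne_zero_of_odd ι₀ j₀ (Φ i₀) ?_) (sum_ksign_ne_zero_of_odd ι₀ j₁ (Φ i₁) ?_)
  · have := two_mul_card_filter_mem_cmType (Φ i₀)
    rwa [← this, Nat.mul_div_cancel_left _ two_pos] at h₀
  · have := two_mul_card_filter_mem_cmType (Φ i₁)
    rwa [← this, Nat.mul_div_cancel_left _ two_pos] at h₁

open scoped Classical in
/-- **No partial conjugations** for such a family: the `Aut(ℂ)`-actions on the `Hom(K_i, ℂ)` admit no system of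
partial conjugations (`σ_i` = conjugation on slot `i`, identity elsewhere) — the Galois closures of `K_{i₀}` and `K_{i₁}`
both contain `ι₀(k)`, which is not totally real. [cite: Gordon1999HodgeAVSurvey, §3 Theorem (proof)] -/
theorem not_forall_exists_partialConj_of_shared_quadratic (hk : finrank ℚ k = 2) (ι₀ : k →+* ℂ) {i₀ i₁ : I}
    (h01 : i₀ ≠ i₁) (j₀ : k →+* K i₀) (j₁ : k →+* K i₁) (Φ : ∀ i, CMType (K i))
    (hd₀ : ∑ φ ∈ Finset.univ.filter (fun φ : K i₀ →+* ℂ => φ ∈ (Φ i₀).1),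
      (if φ.comp j₀ = ι₀ then (1 : ℚ) else -1) ≠ 0)
    (hd₁ : ∑ φ ∈ Finset.univ.filter (fun φ : K i₁ →+* ℂ => φ ∈ (Φ i₁).1),
      (if φ.comp j₁ = ι₀ then (1 : ℚ) else -1) ≠ 0) :
    ¬ ∀ i : I, ∃ σ : ℂ ≃+* ℂ, (∀ s : K i →+* ℂ, σ • s = (starRingAut : ℂ ≃+* ℂ) • s) ∧
      ∀ j, j ≠ i → ∀ s : K j →+* ℂ, σ • s = s := fun hconj => by
  have h1 := typeRank_sigmaType_add_card_eq_of_partialConj (G := ℂ ≃+* ℂ) (Φ := fun i => (Φ i).1)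
    (fun i => isCMTypeWith_conj (Φ i)) hconj
  have h2 := cmFamilyRank_add_card_lt_of_shared_quadratic hk ι₀ h01 j₀ j₁ Φ hd₀ hd₁
  change typeRank (ℂ ≃+* ℂ) (sigmaType fun i => (Φ i).1) + Fintype.card I <
    (∑ i, typeRank (ℂ ≃+* ℂ) (Φ i).1) + 1 at h2
  omega

end Family

end Literature.NumberTheory.ComplexMultiplication

end
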